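import Summits.CriticalPhenomena.SAWScalingLimit.Theorems.SAWLeftRightFKGLeftRightFKGTP2Defs
import Summits.CriticalPhenomena.SAWScalingLimit.Theorems.SAWTotalPositivityBoundaryTP2Kernel
import Summits.CriticalPhenomena.SAWScalingLimit.Theorems.SAWTotalPositivityBoundaryTP2Symmetry
import Summits.CriticalPhenomena.SAWScalingLimit.Theorems.SAWTotalPositivityBoundaryTP2CutVertex
import Summits.CriticalPhenomena.SAWScalingLimit.Theorems.SAWLeftRightFKGLeftRightFKGStubCornerQuadruple
import Summits.CriticalPhenomena.SAWScalingLimit.Theorems.SAWLeftRightFKGLeftRightFKGInterlacedOfGraphTP2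
import Summits.CriticalPhenomena.SAWScalingLimit.Theorems.SAWLeftRightFKGLeftRightFKGGadgetBracket
import Literature.Combinatorics.SimpleGraph.MengerTwo
import HarnessLib

/-!
# `GraphTP2At x →` corner quadruples, via gadgets at the marked points — crux `LeftRightFKG`
(stmt-CriticalPhenomena-11232), line `corner-localisation`, lead c3, registered stub `stub_cornerQuadrupleOfGraphTP2`

`CornerQuadrupleTP2At x` (vocabulary `…LeftRightFKGTP2Defs`) is the only input of c1's corner assembly
`CornerAssembly.corner_of_parts` besides two landed dictionaries: TP₂ of every CORNER QUADRUPLE `(u, w, w', u')` of a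
finite `H ≤ ℤ²` — `u ≠ u'` lattice neighbours of an isolated vertex `p`, `w ≠ w'` lattice neighbours of an isolated
vertex `q ≠ p`, crossed pairing interlaced. Lead c1 derived it from `InterlacedTP2At x`, lead c2 derived
`InterlacedTP2At x` from `GraphTP2At x` plus a general three-point hypothesis. This file derives
`CornerQuadrupleTP2At x` from `GraphTP2At x` and the conclusions of the line's GADGET stubs (chain gadget `hGL`,
two-chain three-point `hTC`, blob bracket `hBG`, 4-cycle bound `hSQ` — all consequences of `GraphTP2At x` for
`0 < x < 1`, proved in their own files), following c1's coincidence analysis and c2's Menger decomposition: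

* `u = w'` / `u' = w`: sub-multiplicativity through the common vertex (c1, no TP₂ input);
* `u = w` and `u' = w'`: `Z(u,u')² ≤ 1` from the 4-cycle bound at `p, q` (`hSQ`);
* `u = w` xor `u' = w'`: the two-chain three-point inequality at the common vertex, chains through `p` and `q` (`hTC`);
* pairwise distinct: a `GraphTP2At` instance, or (Menger for two paths, `ThreePoint.exists_cut_sets`,
  `BoundaryTP2.stub_cutVertex_factor`) a one-vertex cut `z` — between `{u,u'}` and `{w,w'}` the inequality is an
  equality, between `{u,w}` and `{w',u'}` it is the product of two brackets, each supplied by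
  `CornerGadget.bracket_of_gadgets` (blob gadget through `p` or `q`, chain gadget when `z ∈ {u', w'}` resp.
  `z ∈ {u, w}`, second cut / vanishing in the degenerate cases).

Everything here is proved; the gadget statements enter only as hypotheses. [cite: Diestel2017, Thm. 3.3.1]
-/

noncomputable section

open Literature.Probability.LatticeModels Literature.Probability.RandomPlanarGeometry
open Summit.CriticalPhenomena.SAWScalingLimit.Theorems.BoundaryTP2
open Summit.CriticalPhenomena.SAWScalingLimit.Theorems.LeftRightFKG.CornerLoc
open scoped Classical ENNReal

namespace Summit.CriticalPhenomena.SAWScalingLimit.Theorems.LeftRightFKG.CornerGadget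

/-! ## The bracket (general form) -/

/-- Private copy of `CornerGadget.bracket_of_gadgets'` (the general bracket of the Menger decomposition from the
chain/blob gadget statements; landed in `…GadgetBracket.lean`, duplicated here only to decouple this file from the
farm's build order). [folklore] -/
private theorem bracket_general {x : ℝ} (hx : 0 ≤ x)
    (hGL : ∀ (H : SimpleGraph (Site 2)), H ≤ zdGraph 2 → H.support.Finite →
      ∀ c a b p : Site 2, c ≠ a → c ≠ b → a ≠ b → p ∉ H.support → (zdGraph 2).Adj c p → (zdGraph 2).Adj p b →
        (H.deleteEdges (H.incidenceSet c)).Reachable a b → (H.deleteEdges (H.incidenceSet b)).Reachable a c →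
        pathKernel H x c a * pathKernel H x c b ≤ pathKernel H x a b)
    (hBG : ∀ (H : SimpleGraph (Site 2)), H ≤ zdGraph 2 → H.support.Finite →
      ∀ (A B : Set (Site 2)) (z u w u' p : Site 2),
        (∀ v, v ∈ A ∨ v ∈ B) → (∀ v, v ∈ A → v ∈ B → v = z) → z ∈ A → z ∈ B →
        (∀ a b, H.Adj a b → (a ∈ A ∧ b ∈ A) ∨ (a ∈ B ∧ b ∈ B)) →
        u ∈ A → w ∈ A → u' ∈ B → z ≠ u → z ≠ w → z ≠ u' → u ≠ w →
        p ∉ H.support → (zdGraph 2).Adj u p → (zdGraph 2).Adj p u' →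
        pathKernel H x z u' ≠ 0 →
        (H.deleteEdges (H.incidenceSet z)).Reachable u w → (H.deleteEdges (H.incidenceSet u)).Reachable w z →
        pathKernel (SimpleGraph.fromRel fun a b => H.Adj a b ∧ a ∈ A ∧ b ∈ A) x u z *
          pathKernel (SimpleGraph.fromRel fun a b => H.Adj a b ∧ a ∈ A ∧ b ∈ A) x w z ≤ pathKernel H x u w)
    (H : SimpleGraph (Site 2)) (hH : H ≤ zdGraph 2) (hfin : H.support.Finite)
    {A B : Set (Site 2)} {z u w u' w' p q : Site 2}
    (hAB : ∀ v, v ∈ A ∨ v ∈ B) (hc : ∀ v, v ∈ A → v ∈ B → v = z) (hzA : z ∈ A) (hzB : z ∈ B)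
    (hsep : ∀ a b, H.Adj a b → (a ∈ A ∧ b ∈ A) ∨ (a ∈ B ∧ b ∈ B))
    (hu : u ∈ A) (hw : w ∈ A) (hu' : u' ∈ B) (hw' : w' ∈ B) (huw : u ≠ w)
    (hp : p ∉ H.support) (hpu : (zdGraph 2).Adj u p) (hpu' : (zdGraph 2).Adj p u')
    (hq : q ∉ H.support) (hqw : (zdGraph 2).Adj w q) (hqw' : (zdGraph 2).Adj q w')
    (hβu : pathKernel H x z u' ≠ 0) (hβw : pathKernel H x z w' ≠ 0) :
    pathKernel (SimpleGraph.fromRel fun a b => H.Adj a b ∧ a ∈ A ∧ b ∈ A) x u z *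
      pathKernel (SimpleGraph.fromRel fun a b => H.Adj a b ∧ a ∈ A ∧ b ∈ A) x w z ≤ pathKernel H x u w := by
  set GA := SimpleGraph.fromRel fun a b => H.Adj a b ∧ a ∈ A ∧ b ∈ A with hGA
  have hAle : GA ≤ H := ThreePoint.piece_le H A
  -- `z` is one of the two points: `Z(z,z) = 1`
  by_cases hzu : z = u
  · subst hzu
    rw [pathKernel_self, one_mul, pathKernel_comm H x z w]
    exact pathKernel_mono hAle x w z
  by_cases hzw : z = w
  · subst hzw
    rw [pathKernel_self, mul_one]
    exact pathKernel_mono hAle x u z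
  -- `z` separates `u` from `w`: second cut
  by_cases hR : (H.deleteEdges (H.incidenceSet z)).Reachable u w
  swap
  · exact bracket_of_not_reachable_deleteVert hAle x hx hR
  -- the gadgets through `p`
  by_cases hR₁ : (H.deleteEdges (H.incidenceSet u)).Reachable w z
  · by_cases hzu'e : z = u'
    · -- the cut vertex is `u'` itself: chain `u'–p–u`
      have key := hGL H hH hfin z w u p hzw hzu huw.symm hp (hzu'e ▸ hpu'.symm) hpu.symm hR.symm hR₁
      calc pathKernel GA x u z * pathKernel GA x w z
          ≤ pathKernel H x u z * pathKernel H x w z :=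
            mul_le_mul' (pathKernel_mono hAle x u z) (pathKernel_mono hAle x w z)
        _ = pathKernel H x z w * pathKernel H x z u := by
            rw [mul_comm, pathKernel_comm H x w z, pathKernel_comm H x u z]
        _ ≤ pathKernel H x w u := key
        _ = pathKernel H x u w := pathKernel_comm _ _ _ _
    · exact hBG H hH hfin A B z u w u' p hAB hc hzA hzB hsep hu hw hu' hzu hzw hzu'e huw hp hpu hpu' hβu hR hR₁
  -- the gadgets through `q`
  by_cases hR₂ : (H.deleteEdges (H.incidenceSet w)).Reachable u z
  · by_cases hzw'e : z = w'
    · -- the cut vertex is `w'` itself: chain `w'–q–w`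
      have key := hGL H hH hfin z u w q hzu hzw huw hq (hzw'e ▸ hqw'.symm) hqw.symm hR hR₂
      calc pathKernel GA x u z * pathKernel GA x w z
          ≤ pathKernel H x u z * pathKernel H x w z :=
            mul_le_mul' (pathKernel_mono hAle x u z) (pathKernel_mono hAle x w z)
        _ = pathKernel H x z u * pathKernel H x z w := by
            rw [pathKernel_comm H x u z, pathKernel_comm H x w z]
        _ ≤ pathKernel H x u w := key
    · have key := hBG H hH hfin A B z w u w' q hAB hc hzA hzB hsep hw hu hw' hzw hzu hzw'e (Ne.symm huw) hq hqw
        hqw' hβw hR.symm hR₂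
      rwa [mul_comm, pathKernel_comm H x w u] at key
  -- neither: `w` does not reach `z`
  · have h0 : pathKernel H x w z = 0 :=
      pathKernel_eq_zero_of_not_reachable H x (not_reachable_of_two_separations huw hR₁ hR₂)
    have h0' : pathKernel GA x w z = 0 := le_antisymm (h0 ▸ pathKernel_mono hAle x w z) zero_le
    rw [h0', mul_zero]
    exact zero_le

/-! ## The pairwise distinct case: Menger decomposition with gadget brackets -/

/-- **TP₂ of a pairwise distinct corner quadruple from the core and the gadget brackets.** For `0 ≤ x`, `GraphTP2At x`
and the chain/blob gadget statements at fugacity `x`: if `(u, w, w', u')` are pairwise distinct, `u, u'` lattice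
neighbours of an isolated `p`, `w, w'` lattice neighbours of an isolated `q`, and the crossed pairing `(u → w', w → u')`
is interlaced, then `Z(u,w') Z(w,u') ≤ Z(u,w) Z(w',u')`. Proof: c2's Menger decomposition
(`ThreePoint.interlacedTP2At_of_graphTP2At`) with the two brackets taken from `bracket_of_gadgets`. [cite: Diestel2017, Thm. 3.3.1] -/
theorem tp2_distinct_of_gadgets {x : ℝ} (hx : 0 ≤ x) (h₁ : GraphTP2At x)
    (hGL : ∀ (H : SimpleGraph (Site 2)), H ≤ zdGraph 2 → H.support.Finite →
      ∀ c a b p : Site 2, c ≠ a → c ≠ b → a ≠ b → p ∉ H.support → (zdGraph 2).Adj c p → (zdGraph 2).Adj p b →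
        (H.deleteEdges (H.incidenceSet c)).Reachable a b → (H.deleteEdges (H.incidenceSet b)).Reachable a c →
        pathKernel H x c a * pathKernel H x c b ≤ pathKernel H x a b)
    (hBG : ∀ (H : SimpleGraph (Site 2)), H ≤ zdGraph 2 → H.support.Finite →
      ∀ (A B : Set (Site 2)) (z u w u' p : Site 2),
        (∀ v, v ∈ A ∨ v ∈ B) → (∀ v, v ∈ A → v ∈ B → v = z) → z ∈ A → z ∈ B →
        (∀ a b, H.Adj a b → (a ∈ A ∧ b ∈ A) ∨ (a ∈ B ∧ b ∈ B)) →
        u ∈ A → w ∈ A → u' ∈ B → z ≠ u → z ≠ w → z ≠ u' → u ≠ w →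
        p ∉ H.support → (zdGraph 2).Adj u p → (zdGraph 2).Adj p u' →
        pathKernel H x z u' ≠ 0 →
        (H.deleteEdges (H.incidenceSet z)).Reachable u w → (H.deleteEdges (H.incidenceSet u)).Reachable w z →
        pathKernel (SimpleGraph.fromRel fun a b => H.Adj a b ∧ a ∈ A ∧ b ∈ A) x u z *
          pathKernel (SimpleGraph.fromRel fun a b => H.Adj a b ∧ a ∈ A ∧ b ∈ A) x w z ≤ pathKernel H x u w)
    (H : SimpleGraph (Site 2)) (hH : H ≤ zdGraph 2) (hfin : H.support.Finite) {p q u u' w w' : Site 2}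
    (hp : p ∉ H.support) (hq : q ∉ H.support) (hpu : (zdGraph 2).Adj p u) (hpu' : (zdGraph 2).Adj p u')
    (hqw : (zdGraph 2).Adj q w) (hqw' : (zdGraph 2).Adj q w')
    (h12 : u ≠ w) (h13 : u ≠ w') (h14 : u ≠ u') (h23 : w ≠ w') (h24 : w ≠ u') (h34 : w' ≠ u')
    (hI : Interlaced H u w w' u') :
    pathKernel H x u w' * pathKernel H x w u' ≤ pathKernel H x u w * pathKernel H x w' u' := by
  -- trivial when `u` does not reach `w'`
  by_cases hreach : H.Reachable u w'
  swap
  · rw [pathKernel_eq_zero_of_not_reachable H x hreach, zero_mul]; exact zero_le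
  by_cases hiii : DisjointPaths H u u' w w'
  · by_cases hii : DisjointPaths H u w w' u'
    · exact h₁ H hH hfin u w w' u' hI hii hiii
    · -- `(u w | w' u')` not realisable: cut vertex between `{u,u'}` and `{w,w'}`, equality
      obtain ⟨z, -, hz⟩ := Literature.Combinatorics.SimpleGraph.exists_mem_support_forall
        (G := H) (A := Set.univ) (S := {s | s = u ∨ s = u'}) (T := {t | t = w ∨ t = w'})
        (by
          obtain ⟨γ⟩ := hreach
          exact ⟨u, w', γ, Or.inl rfl, Or.inr rfl, fun y _ => Set.mem_univ y⟩)
        (by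
          rintro ⟨s₁, t₁, s₂, t₂, q₁, q₂, hs₁, ht₁, hs₂, ht₂, hq₁, hq₂, -, -, hdisj⟩
          have hs : s₁ ≠ s₂ := by
            rintro rfl; exact hdisj s₁ q₁.start_mem_support q₂.start_mem_support
          have ht : t₁ ≠ t₂ := by
            rintro rfl; exact hdisj t₁ q₁.end_mem_support q₂.end_mem_support
          rw [Set.mem_setOf_eq] at hs₁ hs₂ ht₁ ht₂
          rcases hs₁ with rfl | rfl <;> rcases hs₂ with rfl | rfl
          · exact hs rfl
          · rcases ht₁ with rfl | rfl <;> rcases ht₂ with rfl | rfl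
            · exact ht rfl
            · -- `q₁ : u → w`, `q₂ : u' → w'`
              exact hii ⟨⟨q₁, hq₁⟩, ⟨q₂.reverse, hq₂.reverse⟩, by
                intro y hy hy'
                exact hdisj y hy (by rw [SimpleGraph.Walk.support_reverse, List.mem_reverse] at hy'; exact hy')⟩
            · -- `q₁ : u → w'`, `q₂ : u' → w`
              obtain ⟨v, hv₁, hv₂⟩ := hI ⟨q₁, hq₁⟩ ⟨q₂.reverse, hq₂.reverse⟩
              exact hdisj v hv₁ (by
                rw [SimpleGraph.Walk.support_reverse, List.mem_reverse] at hv₂; exact hv₂)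
            · exact ht rfl
          · rcases ht₁ with rfl | rfl <;> rcases ht₂ with rfl | rfl
            · exact ht rfl
            · -- `q₁ : u' → w`, `q₂ : u → w'`
              obtain ⟨v, hv₁, hv₂⟩ := hI ⟨q₂, hq₂⟩ ⟨q₁.reverse, hq₁.reverse⟩
              exact hdisj v (by
                rw [SimpleGraph.Walk.support_reverse, List.mem_reverse] at hv₂; exact hv₂) hv₁
            · -- `q₁ : u' → w'`, `q₂ : u → w`
              exact hii ⟨⟨q₂, hq₂⟩, ⟨q₁.reverse, hq₁.reverse⟩, by
                intro y hy hy'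
                exact hdisj y (by rw [SimpleGraph.Walk.support_reverse, List.mem_reverse] at hy'; exact hy') hy⟩
            · exact ht rfl
          · exact hs rfl)
      replace hz : ∀ (s t : Site 2) (γ : H.Walk s t), s ∈ ({s | s = u ∨ s = u'} : Set (Site 2)) →
          t ∈ ({t | t = w ∨ t = w'} : Set (Site 2)) → z ∈ γ.support :=
        fun s t γ hs ht => hz s t γ hs ht fun y _ => Set.mem_univ y
      obtain ⟨A, B, hAB, hc, hzA, hzB, hsep, hS, hT⟩ := ThreePoint.exists_cut_sets H _ _ z hz
      have hf := fun s t (hs : s = u ∨ s = u') (ht : t = w ∨ t = w') =>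
        stub_cutVertex_factor H x hx A B z s t hAB hc hzA hzB hsep (hS s hs) (hT t ht)
      rw [hf u w' (Or.inl rfl) (Or.inr rfl), pathKernel_comm H x w u', hf u' w (Or.inr rfl) (Or.inl rfl),
        hf u w (Or.inl rfl) (Or.inl rfl), pathKernel_comm H x w' u', hf u' w' (Or.inr rfl) (Or.inr rfl)]
      exact le_of_eq (by ring)
  · -- `(u u' | w w')` not realisable: cut vertex between `{u,w}` and `{w',u'}`, two brackets
    obtain ⟨z, -, hz⟩ := Literature.Combinatorics.SimpleGraph.exists_mem_support_forall
      (G := H) (A := Set.univ) (S := {s | s = u ∨ s = w}) (T := {t | t = w' ∨ t = u'})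
      (by
        obtain ⟨γ⟩ := hreach
        exact ⟨u, w', γ, Or.inl rfl, Or.inl rfl, fun y _ => Set.mem_univ y⟩)
      (by
        rintro ⟨s₁, t₁, s₂, t₂, q₁, q₂, hs₁, ht₁, hs₂, ht₂, hq₁, hq₂, -, -, hdisj⟩
        have hs : s₁ ≠ s₂ := by
          rintro rfl; exact hdisj s₁ q₁.start_mem_support q₂.start_mem_support
        have ht : t₁ ≠ t₂ := by
          rintro rfl; exact hdisj t₁ q₁.end_mem_support q₂.end_mem_support
        rw [Set.mem_setOf_eq] at hs₁ hs₂ ht₁ ht₂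
        rcases hs₁ with rfl | rfl <;> rcases hs₂ with rfl | rfl
        · exact hs rfl
        · rcases ht₁ with rfl | rfl <;> rcases ht₂ with rfl | rfl
          · exact ht rfl
          · -- `q₁ : u → w'`, `q₂ : w → u'`: interlacing
            obtain ⟨v, hv₁, hv₂⟩ := hI ⟨q₁, hq₁⟩ ⟨q₂, hq₂⟩
            exact hdisj v hv₁ hv₂
          · -- `q₁ : u → u'`, `q₂ : w → w'`
            exact hiii ⟨⟨q₁, hq₁⟩, ⟨q₂, hq₂⟩, by intro y hy hy'; exact hdisj y hy hy'⟩
          · exact ht rfl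
        · rcases ht₁ with rfl | rfl <;> rcases ht₂ with rfl | rfl
          · exact ht rfl
          · -- `q₁ : w → w'`, `q₂ : u → u'`
            exact hiii ⟨⟨q₂, hq₂⟩, ⟨q₁, hq₁⟩, by intro y hy hy'; exact hdisj y hy' hy⟩
          · -- `q₁ : w → u'`, `q₂ : u → w'`: interlacing
            obtain ⟨v, hv₁, hv₂⟩ := hI ⟨q₂, hq₂⟩ ⟨q₁, hq₁⟩
            exact hdisj v hv₂ hv₁
          · exact ht rfl
        · exact hs rfl)
    replace hz : ∀ (s t : Site 2) (γ : H.Walk s t), s ∈ ({s | s = u ∨ s = w} : Set (Site 2)) →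
        t ∈ ({t | t = w' ∨ t = u'} : Set (Site 2)) → z ∈ γ.support :=
      fun s t γ hs ht => hz s t γ hs ht fun y _ => Set.mem_univ y
    obtain ⟨A, B, hAB, hc, hzA, hzB, hsep, hS, hT⟩ := ThreePoint.exists_cut_sets H _ _ z hz
    set GA := SimpleGraph.fromRel fun a b => H.Adj a b ∧ a ∈ A ∧ b ∈ A with hGA
    set GB := SimpleGraph.fromRel fun a b => H.Adj a b ∧ a ∈ B ∧ b ∈ B with hGB
    have hAle : GA ≤ H := ThreePoint.piece_le H A
    have hBle : GB ≤ H := ThreePoint.piece_le H B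
    have hf := fun s t (hs : s = u ∨ s = w) (ht : t = w' ∨ t = u') =>
      stub_cutVertex_factor H x hx A B z s t hAB hc hzA hzB hsep (hS s hs) (hT t ht)
    -- the factorised left-hand side
    have hL : pathKernel H x u w' * pathKernel H x w u' =
        (pathKernel GA x u z * pathKernel GA x w z) * (pathKernel GB x z w' * pathKernel GB x z u') := by
      rw [hf u w' (Or.inl rfl) (Or.inl rfl), hf w u' (Or.inr rfl) (Or.inr rfl)]; ring
    rw [hL]
    -- vanishing brackets
    by_cases hA0 : pathKernel GA x u z * pathKernel GA x w z = 0
    · rw [hA0, zero_mul]; exact zero_le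
    by_cases hB0 : pathKernel GB x z w' * pathKernel GB x z u' = 0
    · rw [hB0, mul_zero]; exact zero_le
    obtain ⟨hA1, hA2⟩ := mul_ne_zero_iff.1 hA0
    obtain ⟨hB3, hB4⟩ := mul_ne_zero_iff.1 hB0
    -- the third points are reached from the cut vertex in `H`
    have hne : ∀ {K : SimpleGraph (Site 2)} {a b : Site 2}, K ≤ H → pathKernel K x a b ≠ 0 →
        pathKernel H x a b ≠ 0 := fun hK hK0 hH0 =>
      hK0 (le_antisymm (hH0 ▸ pathKernel_mono hK x _ _) zero_le)
    have hβu' : pathKernel H x z u' ≠ 0 := hne hBle hB4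
    have hβw' : pathKernel H x z w' ≠ 0 := hne hBle hB3
    have hβu : pathKernel H x z u ≠ 0 := by rw [pathKernel_comm]; exact hne hAle hA1
    have hβw : pathKernel H x z w ≠ 0 := by rw [pathKernel_comm]; exact hne hAle hA2
    -- the two brackets from the gadgets at `p` and `q`
    have hA : pathKernel GA x u z * pathKernel GA x w z ≤ pathKernel H x u w :=
      bracket_general hx hGL hBG H hH hfin hAB hc hzA hzB hsep (hS u (Or.inl rfl)) (hS w (Or.inr rfl))
        (hT u' (Or.inr rfl)) (hT w' (Or.inl rfl)) h12 hp hpu.symm hpu' hq hqw.symm hqw' hβu' hβw'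
    have hB : pathKernel GB x z w' * pathKernel GB x z u' ≤ pathKernel H x w' u' := by
      have hAB' : ∀ v, v ∈ B ∨ v ∈ A := fun v => (hAB v).symm
      have hc' : ∀ v, v ∈ B → v ∈ A → v = z := fun v hvB hvA => hc v hvA hvB
      have hsep' : ∀ a b, H.Adj a b → (a ∈ B ∧ b ∈ B) ∨ (a ∈ A ∧ b ∈ A) := fun a b hab => (hsep a b hab).symm
      have key := bracket_general hx hGL hBG H hH hfin hAB' hc' hzB hzA hsep' (hT u' (Or.inr rfl))
        (hT w' (Or.inl rfl)) (hS u (Or.inl rfl)) (hS w (Or.inr rfl)) h34.symm hp hpu'.symm hpu hq hqw'.symm hqw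
        hβu hβw
      rw [pathKernel_comm GB x z w', pathKernel_comm GB x z u', mul_comm, pathKernel_comm H x w' u']
      exact key
    exact mul_le_mul' hA hB

/-! ## The registered stub -/

/-- REGISTERED STUB `stub_cornerQuadrupleOfGraphTP2` of line `corner-localisation` (skeleton v8, lead c3): for
`0 < x < 1`, `GraphTP2At x` together with the conclusions at fugacity `x` of the chain gadget (`hGL`), the two-chain
three-point inequality (`hTC`), the blob bracket (`hBG`) and the 4-cycle bound (`hSQ`) give `CornerQuadrupleTP2At x`.
Coincidences `u = w'` / `u' = w`: sub-multiplicativity (c1's `CornerQuadruple.tp2_of_interlaced_left_eq/right_eq`);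
`u = w ∧ u' = w'`: `Z(u,u')² ≤ 1` by `hSQ` at `p, q`; `u = w` xor `u' = w'`: `hTC` at the common vertex with chains
through `p` and `q`; pairwise distinct: `tp2_distinct_of_gadgets`. [cite: Diestel2017, Thm. 3.3.1] -/
theorem stub_cornerQuadrupleOfGraphTP2 : ∀ x : ℝ, 0 < x → x < 1 → GraphTP2At x →
    (∀ (H : SimpleGraph (Site 2)), H ≤ zdGraph 2 → H.support.Finite →
      ∀ c a b p : Site 2, c ≠ a → c ≠ b → a ≠ b → p ∉ H.support → (zdGraph 2).Adj c p → (zdGraph 2).Adj p b →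
        (H.deleteEdges (H.incidenceSet c)).Reachable a b → (H.deleteEdges (H.incidenceSet b)).Reachable a c →
        pathKernel H x c a * pathKernel H x c b ≤ pathKernel H x a b) →
    (∀ (H : SimpleGraph (Site 2)), H ≤ zdGraph 2 → H.support.Finite →
      ∀ c a b p q : Site 2, c ≠ a → c ≠ b → a ≠ b → p ≠ q → p ∉ H.support → q ∉ H.support →
        (zdGraph 2).Adj c p → (zdGraph 2).Adj p b → (zdGraph 2).Adj c q → (zdGraph 2).Adj q a →
        pathKernel H x c a * pathKernel H x c b ≤ pathKernel H x a b) →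
    (∀ (H : SimpleGraph (Site 2)), H ≤ zdGraph 2 → H.support.Finite →
      ∀ (A B : Set (Site 2)) (z u w u' p : Site 2),
        (∀ v, v ∈ A ∨ v ∈ B) → (∀ v, v ∈ A → v ∈ B → v = z) → z ∈ A → z ∈ B →
        (∀ a b, H.Adj a b → (a ∈ A ∧ b ∈ A) ∨ (a ∈ B ∧ b ∈ B)) →
        u ∈ A → w ∈ A → u' ∈ B → z ≠ u → z ≠ w → z ≠ u' → u ≠ w →
        p ∉ H.support → (zdGraph 2).Adj u p → (zdGraph 2).Adj p u' →
        pathKernel H x z u' ≠ 0 →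
        (H.deleteEdges (H.incidenceSet z)).Reachable u w → (H.deleteEdges (H.incidenceSet u)).Reachable w z →
        pathKernel (SimpleGraph.fromRel fun a b => H.Adj a b ∧ a ∈ A ∧ b ∈ A) x u z *
          pathKernel (SimpleGraph.fromRel fun a b => H.Adj a b ∧ a ∈ A ∧ b ∈ A) x w z ≤ pathKernel H x u w) →
    (∀ (H : SimpleGraph (Site 2)), H ≤ zdGraph 2 → H.support.Finite →
      ∀ u u' p q : Site 2, u ≠ u' → p ≠ q → p ∉ H.support → q ∉ H.support →
        (zdGraph 2).Adj p u → (zdGraph 2).Adj p u' → (zdGraph 2).Adj q u → (zdGraph 2).Adj q u' →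
        pathKernel H x u u' ≤ 1) →
    CornerQuadrupleTP2At x := by
  intro x hx _hx1 h₁ hGL hTC hBG hSQ H hH hfin p q u u' w w' hpq hp hq hpu hpu' hqw hqw' huu' hww' _ _ hqu _ hI
  by_cases h1 : u = w'
  · subst h1
    exact CornerQuadruple.tp2_of_interlaced_left_eq H x hx.le hI
  by_cases h2 : u' = w
  · subst h2
    exact CornerQuadruple.tp2_of_interlaced_right_eq H x hx.le hI
  by_cases h3 : u = w
  · subst h3
    by_cases h4 : u' = w'
    · subst h4
      rw [pathKernel_self, pathKernel_self, one_mul]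
      have hle : pathKernel H x u u' ≤ 1 := hSQ H hH hfin u u' p q huu' hpq hp hq hpu hpu' hqw hqw'
      calc pathKernel H x u u' * pathKernel H x u u' ≤ 1 * 1 := mul_le_mul' hle hle
        _ = 1 := one_mul 1
    · rw [pathKernel_self, one_mul]
      exact hTC H hH hfin u w' u' p q h1 huu' (Ne.symm h4) hpq hp hq hpu.symm hpu' hqw.symm hqw'
  by_cases h4 : u' = w'
  · subst h4
    rw [pathKernel_self, mul_one]
    have key := hTC H hH hfin u' w u p q h2 (Ne.symm huu') (Ne.symm h3) hpq hp hq hpu'.symm hpu hqw'.symm hqw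
    rw [pathKernel_comm H x u u', pathKernel_comm H x w u', pathKernel_comm H x u w, mul_comm]
    exact key
  -- the generic case: `u, w, w', u'` pairwise distinct
  exact tp2_distinct_of_gadgets hx.le h₁ hGL hBG H hH hfin hp hq hpu hpu' hqw hqw' h3 h1 huu' hww' (Ne.symm h2)
    (Ne.symm h4) hI

end Summit.CriticalPhenomena.SAWScalingLimit.Theorems.LeftRightFKG.CornerGadget

end
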